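import Summits.BirchSwinnertonDyer.BirchSwinnertonDyer.Theorems.ByReductionTypeAtTwoMultTowerNS2LocalCyclotomicAction
import Summits.BirchSwinnertonDyer.BirchSwinnertonDyer.Theorems.ByReductionTypeAtTwoMultTowerNS2LocalLayerField
import Mathlib.RingTheory.Norm.Transitivity
import Mathlib.RingTheory.Adjoin.PowerBasis
import Mathlib.Algebra.Polynomial.Degree.SmallDegree
import Mathlib.Algebra.Order.BigOperators.Group.Finset
import Mathlib.Data.Set.Card
import HarnessLib

/-!
# Route `ByReductionTypeAtTwo`, crux `MultUpperHalfAtTwo` (item stmt-BirchSwinnertonDyer-19922), TOWER road, the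
# «ONE BIT AT A NON-SPLIT 2» rows: KERNEL BRICK 13b — the local layer field `F_m = ℚ_v(y_m)`, `y_m = ζ_{2^{m+2}} + ζ⁻¹`:
# degree `2^m`, minimal polynomial, and the two norms `N(1 + y_m) = −1`, `N(2 + y_m) = 2`

HONEST FRAMING (cell `bsd-2adic`, run/shared/lean/pub/bsd-2adic/, seat `bsd-2adic-tower-1` GEN 9, HUMAN RULINGS
D-0036 / D-0054 / D-0074): TOOL theorems only (no definition, no named fact, no `sorry`); closes nothing by itself;
nothing booked; BSD is not proved by any of this. Module M5 of the KERNELISATION of the MEMO binder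
`MultTowerNS2.localTowerKerTwoTorsion_le_two_nonsplitTwo_of_tateUnit` (scope memo HOME/tower/SCOPE-hNS2one-kernel-GEN8.md).
For `v ∋ 2`, `K = ℚ_v`, `ζ ∈ K̄_v` a primitive `2^{m+2}`-th root of unity and `y = ζ + ζ⁻¹`:

* `exists_layerPoly` — the layer polynomials `P_m` (`P_0 = X`, `P_{m+1} = P_m(X² − 2)`): monic of degree `2^m`,
  `P_m(−1) = −1`, `P_m(2) = 2`, `P_m(−2) = 2` (`m ≥ 1`), `P_m(z + z⁻¹) = z^{2^m} + z^{−2^m}`;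
* `two_pow_le_finrank_adjoin_add_inv` — `[K(y) : K] ≥ 2^m` (the `2^m` distinct conjugates `ζ^c + ζ^{−c}`, `c` odd
  modulo `±`, BRICK 13a `exists_smul_eq_pow`, are roots of the minimal polynomial);
* `fixedField_localSubgroup_layerSubgroup_eq_adjoin` — **`F_m = K(y)`** and `[K(y) : K] = 2^m` (`y ∈ F_m` by
  BRICK 13a, `[F_m : K] = 2^m` by BRICK 9); `minpoly_add_inv_eq` — `P_m` is the minimal polynomial of `y`;
* `norm_add_gen_eq` — **`N_{F_m/K}(c + y) = P_m(−c)` for `m ≥ 1`**, whence `N(1 + y) = −1` and `N(2 + y) = 2`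
  (`norm_one_add_eq_and_norm_two_add_eq`: `−1` and `2` are norms from every local layer of the cyclotomic
  `ℤ₂`-tower — step S5 of the scope memo).

References: L. Washington, *Introduction to Cyclotomic Fields*, §13.1, Prop. 2.16; scope memo M5/S5.
-/

set_option autoImplicit false
-- the Theorems namespace of this sub repeats the summit name by design (D-0017 nested layout: Summit.<S>.<Sub>)
set_option linter.dupNamespace false

noncomputable section

open scoped Classical IntermediateField

namespace Summit.BirchSwinnertonDyer.BirchSwinnertonDyer.Theorems.MultTowerNS2

open NumberField IsDedekindDomain Field Polynomial Literature.NumberTheory.EllipticCurves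
  Literature.NumberTheory.GaloisRepresentations

/-! ### The polynomials `P_m` -/

/-- **The layer polynomials.** For every field `K` and `m ≥ 0` there is a monic `P ∈ K[X]` of degree `2^m` with
`P(−1) = −1`, `P(2) = 2`, `P(−2) = 2` when `m ≠ 0`, and `P(z + z⁻¹) = z^{2^m} + z^{−2^m}` for every non-zero `z` in a
field extension (`P_0 = X`, `P_{m+1} = P_m(X² − 2)`; over `ℚ`, `P_m` is the minimal polynomial of `2cos(2π/2^{m+2})`).
[cite: Washington1997, Prop. 2.16] -/
theorem exists_layerPoly (K : Type*) [Field K] (m : ℕ) :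
    ∃ P : K[X], P.Monic ∧ P.natDegree = 2 ^ m ∧ P.eval (-1) = -1 ∧ P.eval 2 = 2 ∧ (m ≠ 0 → P.eval (-2) = 2) ∧
      ∀ (L : Type*) [Field L] [Algebra K L] (z : L), z ≠ 0 → aeval (z + z⁻¹) P = z ^ 2 ^ m + z⁻¹ ^ 2 ^ m := by
  induction m with
  | zero =>
    exact ⟨X, monic_X, by simp, by simp, by simp, fun h ↦ (h rfl).elim, fun L _ _ z _ ↦ by simp⟩
  | succ m ih =>
    obtain ⟨P, hmon, hdeg, h1, h2, -, hz⟩ := ih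
    have hQ : (X ^ 2 - C (2 : K)).Monic := monic_X_pow_sub_C _ two_ne_zero
    have hQd : (X ^ 2 - C (2 : K)).natDegree = 2 := natDegree_X_pow_sub_C
    refine ⟨P.comp (X ^ 2 - C 2), hmon.comp hQ (by rw [hQd]; norm_num), ?_, ?_, ?_, fun _ ↦ ?_, ?_⟩
    · rw [natDegree_comp, hdeg, hQd, pow_succ]
    · rw [eval_comp, eval_sub, eval_pow, eval_X, eval_C]; norm_num; exact h1
    · rw [eval_comp, eval_sub, eval_pow, eval_X, eval_C]; norm_num; exact h2
    · rw [eval_comp, eval_sub, eval_pow, eval_X, eval_C]; norm_num; exact h2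
    · intro L _ _ z hz0
      rw [aeval_comp]
      have hq : aeval (z + z⁻¹) (X ^ 2 - C (2 : K)) = z ^ 2 + (z ^ 2)⁻¹ := by
        rw [map_sub, map_pow, aeval_X, aeval_C, map_ofNat]
        field_simp
        ring
      rw [hq, hz L (z ^ 2) (pow_ne_zero 2 hz0), ← inv_pow, ← pow_mul, ← pow_mul, show 2 * 2 ^ m = 2 ^ (m + 1) by ring]

/-- The value of `P_m` at `y = ζ + ζ⁻¹` for a PRIMITIVE `2^{m+2}`-th root of unity vanishes:
`ζ^{2^m} = i` with `i² = −1`, so `i + i⁻¹ = 0`. [cite: Washington1997, Prop. 2.16] -/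
theorem aeval_add_inv_eq_zero_of_isPrimitiveRoot {K L : Type*} [Field K] [Field L] [Algebra K L] {m : ℕ} {P : K[X]}
    (hP : ∀ z : L, z ≠ 0 → aeval (z + z⁻¹) P = z ^ 2 ^ m + z⁻¹ ^ 2 ^ m) {ζ : L}
    (hζ : IsPrimitiveRoot ζ (2 ^ (m + 2))) : aeval (ζ + ζ⁻¹) P = 0 := by
  have hζ0 : ζ ≠ 0 := hζ.ne_zero (pow_ne_zero _ two_ne_zero)
  rw [hP ζ hζ0]
  set i := ζ ^ 2 ^ m with hi
  have hi2 : i ^ 2 = -1 := by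
    have h4 : (i ^ 2) ^ 2 = 1 := by
      rw [hi, show ((ζ ^ 2 ^ m) ^ 2) ^ 2 = ζ ^ 2 ^ (m + 2) by ring, hζ.pow_eq_one]
    have hne : i ^ 2 ≠ 1 := by
      rw [hi, show (ζ ^ 2 ^ m) ^ 2 = ζ ^ 2 ^ (m + 1) by ring]
      exact hζ.pow_ne_one_of_pos_of_lt (pow_ne_zero _ two_ne_zero)
        (Nat.pow_lt_pow_right (by norm_num) (by omega))
    rcases sq_eq_one_iff.mp h4 with h | h
    · exact absurd h hne
    · exact h
  have hi0 : i ≠ 0 := pow_ne_zero _ hζ0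
  rw [inv_pow, ← hi]
  have : i⁻¹ = -i := inv_eq_of_mul_eq_one_right (by linear_combination -hi2)
  rw [this, add_neg_cancel]

variable {κ : ZpExtension ℚ 2}

/-! ### `[K(y) : K] ≥ 2^m` by counting conjugates, and `F_m = K(y)` -/

/-- **`[ℚ_v(ζ + ζ⁻¹) : ℚ_v] ≥ 2^m`** (`v ∋ 2`, `ζ` a primitive `2^{m+2}`-th root of unity): the conjugates
`σ(ζ + ζ⁻¹) = ζ^c + ζ^{−c}` (`c` odd, BRICK 13a `exists_smul_eq_pow`) are roots of the minimal polynomial of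
`y = ζ + ζ⁻¹`, and `ζ^c + ζ^{−c} = ζ^{c'} + ζ^{−c'}` only for `c' = ±c`: at least `2^{m+1}/2` distinct roots.
[cite: SerreLocalFields1979, Ch. IV §4 Prop. 17] -/
theorem two_pow_le_finrank_adjoin_add_inv (v : HeightOneSpectrum (𝓞 ℚ)) (hv : ((2 : ℕ) : 𝓞 ℚ) ∈ v.asIdeal) (m : ℕ)
    {ζ : AlgebraicClosure (v.adicCompletion ℚ)} (hζ : IsPrimitiveRoot ζ (2 ^ (m + 2))) :
    2 ^ m ≤ Module.finrank (v.adicCompletion ℚ) (v.adicCompletion ℚ)⟮ζ + ζ⁻¹⟯ := by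
  set K := v.adicCompletion ℚ
  set y := ζ + ζ⁻¹ with hy
  have hζ0 : ζ ≠ 0 := hζ.ne_zero (pow_ne_zero _ two_ne_zero)
  have hint : IsIntegral K y := Algebra.IsIntegral.isIntegral y
  rw [IntermediateField.adjoin.finrank hint]
  set P := minpoly K y with hP
  have hP0 : P ≠ 0 := minpoly.ne_zero hint
  -- the conjugates `ζ^c + ζ^{-c}`
  let f : (ZMod (2 ^ (m + 2)))ˣ → AlgebraicClosure K :=
    fun c ↦ ζ ^ (c : ZMod (2 ^ (m + 2))).val + (ζ ^ (c : ZMod (2 ^ (m + 2))).val)⁻¹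
  have hroot : ∀ c, f c ∈ P.rootSet (AlgebraicClosure K) := by
    intro c
    obtain ⟨σ, hσ⟩ := exists_smul_eq_pow v hv (m + 2) c hζ.pow_eq_one
    rw [Polynomial.mem_rootSet_of_ne hP0]
    let σ' : AlgebraicClosure K ≃ₐ[K] AlgebraicClosure K := σ
    have hσy : (σ' : AlgebraicClosure K →ₐ[K] AlgebraicClosure K) y = f c := by
      change σ' (ζ + ζ⁻¹) = _
      rw [map_add, map_inv₀, show σ' ζ = σ • ζ from rfl, hσ]
    rw [← hσy, Polynomial.aeval_algHom_apply, hP, minpoly.aeval, map_zero]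
  -- fibres of `f` have at most two elements `{c, -c}`
  haveI : Fact (1 < 2 ^ (m + 2)) := ⟨Nat.one_lt_pow (by omega) (by norm_num)⟩
  have hfib : ∀ c c' : (ZMod (2 ^ (m + 2)))ˣ, f c = f c' → c' = c ∨ c' = -c := by
    intro c c' h
    set a := ζ ^ (c : ZMod (2 ^ (m + 2))).val with ha
    set b := ζ ^ (c' : ZMod (2 ^ (m + 2))).val with hb
    have ha0 : a ≠ 0 := pow_ne_zero _ hζ0
    have hb0 : b ≠ 0 := pow_ne_zero _ hζ0
    have h' : a + a⁻¹ = b + b⁻¹ := h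
    have hab : (a - b) * (a * b - 1) = 0 := by
      field_simp at h'
      linear_combination h'
    rcases mul_eq_zero.mp hab with h1 | h1
    · left
      have := hζ.pow_inj (ZMod.val_lt _) (ZMod.val_lt _) (sub_eq_zero.mp h1).symm
      exact Units.ext (ZMod.val_injective _ this)
    · right
      have hab1 : ζ ^ ((c : ZMod (2 ^ (m + 2))).val + (c' : ZMod (2 ^ (m + 2))).val) = 1 := by
        rw [pow_add, ← ha, ← hb]; linear_combination h1
      have hdvd := (hζ.pow_eq_one_iff_dvd _).mp hab1
      have hsum : ((c : ZMod (2 ^ (m + 2))) + (c' : ZMod (2 ^ (m + 2)))) = 0 := by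
        rw [← ZMod.natCast_zmod_val (c : ZMod (2 ^ (m + 2))), ← ZMod.natCast_zmod_val (c' : ZMod (2 ^ (m + 2))),
          ← Nat.cast_add, ZMod.natCast_eq_zero_iff]
        exact hdvd
      exact Units.ext (by rw [Units.val_neg]; linear_combination hsum)
  -- counting
  have hcount : (Finset.univ : Finset (ZMod (2 ^ (m + 2)))ˣ).card ≤ 2 * (Finset.univ.image f).card := by
    refine Finset.card_le_mul_card_image _ 2 fun b hb ↦ ?_
    obtain ⟨c, -, rfl⟩ := Finset.mem_image.mp hb
    calc (Finset.univ.filter fun a ↦ f a = f c).card ≤ ({c, -c} : Finset _).card := by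
          refine Finset.card_le_card fun c' hc' ↦ ?_
          rw [Finset.mem_filter] at hc'
          rcases hfib c c' hc'.2.symm with h | h <;> simp [h]
      _ ≤ 2 := Finset.card_le_two
  have huniv : (Finset.univ : Finset (ZMod (2 ^ (m + 2)))ˣ).card = 2 ^ (m + 1) := by
    rw [Finset.card_univ, ZMod.card_units_eq_totient, Nat.totient_prime_pow Nat.prime_two (by omega)]
    simp
  have himg : (Finset.univ.image f).card ≤ P.natDegree := by
    calc (Finset.univ.image f).card = ((Finset.univ.image f : Finset _) : Set (AlgebraicClosure K)).ncard := by
          rw [Set.ncard_coe_finset]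
      _ ≤ (P.rootSet (AlgebraicClosure K)).ncard := by
          refine Set.ncard_le_ncard (fun x hx ↦ ?_) (P.rootSet_finite _)
          obtain ⟨c, -, rfl⟩ := Finset.mem_image.mp (Finset.mem_coe.mp hx)
          exact hroot c
      _ ≤ P.natDegree := P.ncard_rootSet_le _
  have h2 : 2 ^ (m + 1) = 2 * 2 ^ m := by ring
  omega

/-- **`F_m = ℚ_v(ζ + ζ⁻¹)` and `[ℚ_v(ζ + ζ⁻¹) : ℚ_v] = 2^m`**: for the cyclotomic `ℤ₂`-extension `κ`, `v ∋ 2` and a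
primitive `2^{m+2}`-th root of unity `ζ ∈ K̄_v`, the fixed field of the local layer subgroup `H_m` is `K(ζ + ζ⁻¹)`
(`ζ + ζ⁻¹ ∈ F_m` by BRICK 13a, `[F_m : K] = 2^m` by BRICK 9, `[K(ζ + ζ⁻¹) : K] ≥ 2^m`). [cite: Washington1997, §13.1] -/
theorem fixedField_localSubgroup_layerSubgroup_eq_adjoin (hκ : κ.IsCyclotomic) (v : HeightOneSpectrum (𝓞 ℚ))
    (hv : ((2 : ℕ) : 𝓞 ℚ) ∈ v.asIdeal) (m : ℕ) {ζ : AlgebraicClosure (v.adicCompletion ℚ)}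
    (hζ : IsPrimitiveRoot ζ (2 ^ (m + 2))) :
    IntermediateField.fixedField (localSubgroup (κ.layerSubgroup m) (v.adicCompletion ℚ)) =
        (v.adicCompletion ℚ)⟮ζ + ζ⁻¹⟯ ∧
      Module.finrank (v.adicCompletion ℚ) (v.adicCompletion ℚ)⟮ζ + ζ⁻¹⟯ = 2 ^ m := by
  set K := v.adicCompletion ℚ
  set F := IntermediateField.fixedField (localSubgroup (κ.layerSubgroup m) (v.adicCompletion ℚ))
  haveI : FiniteDimensional K F := finiteDimensional_fixedField_localSubgroup_layerSubgroup (κ := κ) v m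
  have hFrank : Module.finrank K F = 2 ^ m := finrank_fixedField_localSubgroup_layerSubgroup hκ v hv m
  have hle : K⟮ζ + ζ⁻¹⟯ ≤ F :=
    IntermediateField.adjoin_simple_le_iff.mpr (add_inv_mem_fixedField_localSubgroup_layerSubgroup hκ v m hζ.pow_eq_one)
  have hup : Module.finrank K K⟮ζ + ζ⁻¹⟯ ≤ 2 ^ m := hFrank ▸ IntermediateField.finrank_le_of_le_right hle
  have hrank : Module.finrank K K⟮ζ + ζ⁻¹⟯ = 2 ^ m := le_antisymm hup (two_pow_le_finrank_adjoin_add_inv v hv m hζ)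
  exact ⟨(IntermediateField.eq_of_le_of_finrank_eq hle (hrank.trans hFrank.symm)).symm, hrank⟩

/-- **The minimal polynomial of `y = ζ + ζ⁻¹` over `ℚ_v` is `P_m`**: any monic `P` of degree `2^m` with
`P(z + z⁻¹) = z^{2^m} + z^{−2^m}` kills `y` and has the degree `[K(y) : K] = 2^m` of the minimal polynomial.
[cite: Washington1997, Prop. 2.16] -/
theorem minpoly_add_inv_eq (hκ : κ.IsCyclotomic) (v : HeightOneSpectrum (𝓞 ℚ)) (hv : ((2 : ℕ) : 𝓞 ℚ) ∈ v.asIdeal)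
    (m : ℕ) {ζ : AlgebraicClosure (v.adicCompletion ℚ)} (hζ : IsPrimitiveRoot ζ (2 ^ (m + 2)))
    {P : (v.adicCompletion ℚ)[X]} (hmon : P.Monic) (hdeg : P.natDegree = 2 ^ m)
    (hP : ∀ z : AlgebraicClosure (v.adicCompletion ℚ), z ≠ 0 → aeval (z + z⁻¹) P = z ^ 2 ^ m + z⁻¹ ^ 2 ^ m) :
    minpoly (v.adicCompletion ℚ) (ζ + ζ⁻¹) = P := by
  set K := v.adicCompletion ℚ
  have hint : IsIntegral K (ζ + ζ⁻¹) := Algebra.IsIntegral.isIntegral _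
  have h0 : aeval (ζ + ζ⁻¹) P = 0 := aeval_add_inv_eq_zero_of_isPrimitiveRoot hP hζ
  have hdvd : minpoly K (ζ + ζ⁻¹) ∣ P := minpoly.dvd K _ h0
  have hdeg' : (minpoly K (ζ + ζ⁻¹)).natDegree = 2 ^ m := by
    rw [← IntermediateField.adjoin.finrank hint, (fixedField_localSubgroup_layerSubgroup_eq_adjoin hκ v hv m hζ).2]
  exact (Polynomial.eq_of_monic_of_dvd_of_natDegree_le (minpoly.monic hint) hmon hdvd (by rw [hdeg, hdeg'])).symm

/-! ### The norms `N(c + y) = P_m(−c)` -/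

/-- **`N_{F_m/ℚ_v}(c + y) = P_m(−c)`** (`m ≥ 1`, `c ∈ ℚ_v`, `y = ζ + ζ⁻¹`, `P_m` its minimal polynomial): `c + y`
generates `F_m`, its minimal polynomial is `P_m(X − c)`, and the norm of a generator is `(−1)^{2^m}` times the
constant coefficient. [cite: Washington1997, Prop. 2.16] -/
theorem norm_add_gen_eq (hκ : κ.IsCyclotomic) (v : HeightOneSpectrum (𝓞 ℚ)) (hv : ((2 : ℕ) : 𝓞 ℚ) ∈ v.asIdeal)
    {m : ℕ} (hm : 1 ≤ m) {ζ : AlgebraicClosure (v.adicCompletion ℚ)} (hζ : IsPrimitiveRoot ζ (2 ^ (m + 2)))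
    (c : v.adicCompletion ℚ) :
    Algebra.norm (v.adicCompletion ℚ)
        (algebraMap (v.adicCompletion ℚ) _ c +
          (⟨ζ + ζ⁻¹, add_inv_mem_fixedField_localSubgroup_layerSubgroup hκ v m hζ.pow_eq_one⟩ :
            IntermediateField.fixedField (localSubgroup (κ.layerSubgroup m) (v.adicCompletion ℚ)))) =
      (minpoly (v.adicCompletion ℚ) (ζ + ζ⁻¹)).eval (-c) := by
  obtain ⟨hFeq, hrank⟩ := fixedField_localSubgroup_layerSubgroup_eq_adjoin hκ v hv m hζ
  have hint : IsIntegral (v.adicCompletion ℚ) (ζ + ζ⁻¹) := Algebra.IsIntegral.isIntegral _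
  haveI : FiniteDimensional (v.adicCompletion ℚ) (v.adicCompletion ℚ)⟮ζ + ζ⁻¹⟯ :=
    IntermediateField.adjoin.finiteDimensional hint
  -- work in `K(y)` with the generator `x = c + y`
  let g : (v.adicCompletion ℚ)⟮ζ + ζ⁻¹⟯ := IntermediateField.AdjoinSimple.gen (v.adicCompletion ℚ) (ζ + ζ⁻¹)
  let x : (v.adicCompletion ℚ)⟮ζ + ζ⁻¹⟯ := algebraMap (v.adicCompletion ℚ) _ c + g
  have hxint : IsIntegral (v.adicCompletion ℚ) x := IsIntegral.of_finite _ x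
  have htop : Algebra.adjoin (v.adicCompletion ℚ) ({x} : Set (v.adicCompletion ℚ)⟮ζ + ζ⁻¹⟯) = ⊤ := by
    have hg : Algebra.adjoin (v.adicCompletion ℚ) ({g} : Set (v.adicCompletion ℚ)⟮ζ + ζ⁻¹⟯) = ⊤ :=
      (IntermediateField.adjoin.powerBasis hint).adjoin_gen_eq_top
    rw [eq_top_iff, ← hg, Algebra.adjoin_le_iff, Set.singleton_subset_iff]
    have hx' : x ∈ Algebra.adjoin (v.adicCompletion ℚ) ({x} : Set (v.adicCompletion ℚ)⟮ζ + ζ⁻¹⟯) :=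
      Algebra.subset_adjoin (Set.mem_singleton x)
    have : g = x - algebraMap (v.adicCompletion ℚ) _ c := by simp [x]
    rw [SetLike.mem_coe, this]
    exact Subalgebra.sub_mem _ hx' (Subalgebra.algebraMap_mem _ c)
  let pb : PowerBasis (v.adicCompletion ℚ) (v.adicCompletion ℚ)⟮ζ + ζ⁻¹⟯ := PowerBasis.ofAdjoinEqTop hxint htop
  have hnormx : Algebra.norm (v.adicCompletion ℚ) x = (minpoly (v.adicCompletion ℚ) (ζ + ζ⁻¹)).eval (-c) := by
    have h := Algebra.PowerBasis.norm_gen_eq_coeff_zero_minpoly pb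
    rw [PowerBasis.ofAdjoinEqTop_gen, PowerBasis.ofAdjoinEqTop_dim] at h
    have hminx : minpoly (v.adicCompletion ℚ) x = (minpoly (v.adicCompletion ℚ) (ζ + ζ⁻¹)).comp (X - C c) := by
      rw [show x = g + algebraMap (v.adicCompletion ℚ) _ c from add_comm _ _, minpoly.add_algebraMap,
        IntermediateField.minpoly_gen]
    rw [h, hminx, natDegree_comp, natDegree_X_sub_C, mul_one, coeff_zero_eq_eval_zero, eval_comp, eval_sub, eval_X,
      eval_C, zero_sub, ← IntermediateField.adjoin.finrank hint, hrank]
    rw [show ((-1 : v.adicCompletion ℚ) ^ 2 ^ m) = 1 from (Even.neg_one_pow ⟨2 ^ (m - 1), by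
      rw [← two_mul, ← pow_succ', Nat.sub_add_cancel hm]⟩), one_mul]
  -- transport along `K(y) = F_m`
  have key : Algebra.norm (v.adicCompletion ℚ) (IntermediateField.equivOfEq hFeq.symm x) =
      (minpoly (v.adicCompletion ℚ) (ζ + ζ⁻¹)).eval (-c) := by
    rw [Algebra.norm_eq_of_algEquiv, hnormx]
  convert key using 2
  apply Subtype.ext
  simp [x, g, IntermediateField.equivOfEq_apply]

/-- **`−1` and `2` are norms from every local layer `F_m` (`m ≥ 1`) of the cyclotomic `ℤ₂`-tower at `v ∋ 2`**:
`N_{F_m/ℚ_v}(1 + y_m) = −1` and `N_{F_m/ℚ_v}(2 + y_m) = 2`, `y_m = ζ_{2^{m+2}} + ζ⁻¹` (`P_m(−1) = −1`, `P_m(−2) = 2`).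
[cite: Washington1997, Prop. 2.16] -/
theorem norm_one_add_eq_and_norm_two_add_eq (hκ : κ.IsCyclotomic) (v : HeightOneSpectrum (𝓞 ℚ))
    (hv : ((2 : ℕ) : 𝓞 ℚ) ∈ v.asIdeal) {m : ℕ} (hm : 1 ≤ m) {ζ : AlgebraicClosure (v.adicCompletion ℚ)}
    (hζ : IsPrimitiveRoot ζ (2 ^ (m + 2))) :
    Algebra.norm (v.adicCompletion ℚ)
        (1 + (⟨ζ + ζ⁻¹, add_inv_mem_fixedField_localSubgroup_layerSubgroup hκ v m hζ.pow_eq_one⟩ :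
          IntermediateField.fixedField (localSubgroup (κ.layerSubgroup m) (v.adicCompletion ℚ)))) = -1 ∧
      Algebra.norm (v.adicCompletion ℚ)
        (2 + (⟨ζ + ζ⁻¹, add_inv_mem_fixedField_localSubgroup_layerSubgroup hκ v m hζ.pow_eq_one⟩ :
          IntermediateField.fixedField (localSubgroup (κ.layerSubgroup m) (v.adicCompletion ℚ)))) = 2 := by
  set K := v.adicCompletion ℚ
  obtain ⟨P, hmon, hdeg, h1, -, h2, hz⟩ := exists_layerPoly K m
  have hmin : minpoly K (ζ + ζ⁻¹) = P := minpoly_add_inv_eq hκ v hv m hζ hmon hdeg (hz _)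
  have hc1 := norm_add_gen_eq hκ v hv hm hζ 1
  have hc2 := norm_add_gen_eq hκ v hv hm hζ 2
  rw [map_one] at hc1
  rw [map_ofNat] at hc2
  rw [hc1, hc2, hmin, h1, h2 (by omega)]
  exact ⟨rfl, rfl⟩

end Summit.BirchSwinnertonDyer.BirchSwinnertonDyer.Theorems.MultTowerNS2

end
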